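import Summits.QuantumFields.YangMills.Theorems.BalabanUVNodesN18HLayerW1TwoRadii
import Summits.QuantumFields.YangMills.Theorems.BalabanUVNodesN18HLayerW1Recursion

/-!
# BalabanUVNodes ∕ N18 — THE TWO-TABLE CHAIN AT THE READING: L05 ∕ L06 at a level pairing and at the ADMISSIBLE PAIRING OF RECORD from (STEP₂), and the
# GENERATED towers from (GEN₂) — the step's H-layer pair asked on print's LARGER table `sp′`, the readings and the inductive assumptions on `sp` (Track A, DAG
# node N18 = NE5 `T4OutputRate.NE5 EA EB W κ θ C₅` :211; cluster K4 «SpineRates»; file 22 of seat pub-ymgap-dag-n18-c, row s1, generation 5; companion of file 21)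

Cell `pub-ymgap`, HUMAN RULING D-0062 (Track A), R134 ACCELERATION seat `pub-ymgap-dag-n18-c` (strategy s1), generation 5.  THEOREMS ONLY (no `def` ∕ `instance` ∕
`sorry`); imports file 21 `…N18HLayerW1TwoRadii` and file 17 `…N18HLayerW1Recursion` (W1's `HistoryRecursionOfRecord`, `RateRecordW1MapsAdm`) BY NAME; restates nothing.

WHY.  File 21 re-ran [I] Theorem 1's induction on a table PAIR `(sp, sp′)` linked by print's clause «Z ⊂ X ⟹ sp X ⊆ sp′ Z» ([II] p. 15) and proved the clause for
the pair of record for EVERY residual recipe.  THIS FILE carries the pair through the remaining consumers of the one-table chain: the levels leaves L05 ∕ L06 at a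
level pairing (file 10 §4) and at the ADMISSIBLE PAIRING OF RECORD `LevelPairing.ofRecordAdm` (file 15 §Admissible: readings IN `sp` by type) from (STEP₂), and
node00-def-W1's GENERATED towers (file 17: (GEN₂) = the generator's activities analytic ∕ (2.38)-bounded on `sp′ (k+1)` given older terms admissible on `sp`)
— so dag-n18-d's junctions m14 ∕ m15 have print-shaped producers whose restriction clause is a theorem at the table of record independently of (C3).

WHAT (theorems only).
* §1 `decayBound_EA_of_bound238_table₂` ∕ `decayBound_EB_of_bound238_table₂` — L05 ∕ L06 at a level pairing `R` from the per-step pair on `sp′`, readings in `sp`.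
* §2 `decayBound_EA_ofRecordAdm_of_inductiveStep₂` ∕ `decayBound_EB_ofRecordAdm_of_inductiveStep₂` — at `LevelPairing.ofRecordAdm F M N k sp …` from (STEP₂).
* §3 (GEN₂): `recTerm_inductiveAssumptions_of_stepGen₂` (every generated term obeys both inductive assumptions on `sp`), `recAdmissible_of_stepGen₂` (W1's
  `RecAdmissible`), `termBound118_toClusterTower_of_stepGen₂`, `termAnalytic_toClusterTower_of_stepGen₂`.
* §4 `decayBound_EA_ofRecordAdm_toClusterTower_of_stepGen₂` ∕ `decayBound_EB_ofRecordAdm_toClusterTower_of_stepGen₂` — L05 ∕ L06 of the END at the admissible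
  pairing of record for generated towers from (GEN₂) alone.

HONEST FRAMING.  Count-neutral kernel bookkeeping (files 10 ∕ 15 ∕ 17's proofs with `sp′` at the step's pair); NOT a discharge of N18 (typed 28∕28 · discharged 5∕27
UNCHANGED); the pair on the larger table is NODE A's ∕ N10's content for the terms of record, DISPLAYED; NE5 NOT IN PRINT ∕ NOT PROVED; finite four-torus at fixed ε —
NOT infinite volume ∕ OS ∕ mass gap ∕ Clay.  0 `sorry`, 0 `def`, standard axioms.

References (TYPES only): [I] = [Balaban1987RG1] (0.24)–(0.25) p. 257, (1.18) p. 263, Thm 1 p. 259, (2.13) p. 268; [II] = [Balaban1988RG2Cluster] p. 15, (2.38) p. 20,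
(2.41) p. 21, p. 22.
-/

noncomputable section

namespace Summit.QuantumFields.YangMills.BalabanUVNodes.N18HLayerW1TwoRadiiReading

open Set Metric
open scoped Matrix.Norms.L2Operator
open Literature.MathematicalPhysics.QuantumFieldTheory.Balaban1983to89
open Literature.MathematicalPhysics.QuantumFieldTheory.Balaban1983to89.T4Continuum (T4Family)
open Literature.MathematicalPhysics.QuantumFieldTheory.Balaban1983to89.T4OutputRate
open Literature.MathematicalPhysics.QuantumFieldTheory.Balaban1983to89.B12TreeDecay (K₀)
open Literature.MathematicalPhysics.QuantumFieldTheory.Balaban1983to89.Node00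
open Literature.MathematicalPhysics.QuantumFieldTheory.Balaban1983to89.Node00.Sect2 (domSys CPair ofBackgroundC)
open Literature.MathematicalPhysics.QuantumFieldTheory.Balaban1983to89.Node00.W1
open Summit.QuantumFields.YangMills.BalabanUVNodes.N18HLayerW1Config (prependCoupling_mem_window)
open Summit.QuantumFields.YangMills.BalabanUVNodes.N18HLayerW1TwoRadii (analyticOnNhd_and_bound_E_of_bound238_table_four₂ termBound118_of_bound238_table₂
  hLayer_all_of_inductiveStep₂)
open YMDAG.N22.W1 (decayBound_functionalOn_of_termBound118)

/-! ## §1 L05 ∕ L06 at a level pairing from the per-step pair on the larger tables -/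

section Reading

variable {F : T4Family} {𝔸 : Type*} [NormedRing 𝔸] [NormedAlgebra ℂ 𝔸] {M k : ℕ} (R : LevelPairing F 𝔸 M k)

open Classical in
/-- **L05 AT A LEVEL PAIRING ON A TABLE PAIR** — `DecayBound (R.EA S) (Window γ) (e·9·64·K₀(64,8)²·A) r₁`: the readings `R.embA U` in `sp` (`hembA`), print's clause
`hrestr` between `sp` and `sp′`, run A's per-step pair on `sp′`, the located rate clause and the STRICT [KP86] clause (file 21 §2 feeds n22-c's
`decayBound_functionalOn_of_termBound118`). [cite: Balaban1987RG1, (0.25) p.257 and (1.18) p.263; Balaban1988RG2Cluster, p.15 and (2.41) p.21] -/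
theorem decayBound_EA_of_bound238_table₂ (S : ClusterTower (F.P k) 𝔸 M)
    (sp sp' : (j : ℕ) → (domSys (F.P k) M j).Dom → Set (CPair (F.P k) 𝔸)) {γ A Rr r₁ : ℝ}
    (hembA : ∀ (j : ℕ) (U : R.BgA) (X : (domSys (F.P k) M j).Dom), R.embA U ∈ sp j X)
    (hrestr : ∀ m, ∀ X Z : (domSys (F.P k) M (m + 1)).Dom, Z.1 ⊆ X.1 → sp (m + 1) X ⊆ sp' (m + 1) Z)
    (han : ∀ m, (S m).AnalyticH (box γ m) (sp' (m + 1))) (h238 : ∀ m, (S m).Bound238 (box γ m) (sp' (m + 1)) A Rr) (hA : 0 ≤ A) (hr₁ : 0 ≤ r₁)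
    (hrate : r₁ + 2 * (64 * Real.log 162) + 2 ≤ Rr) (hsmall : A * Real.exp (5 * r₁ + 1) * K₀ 64 8 * 9 * 64 < 1) :
    DecayBound (R.EA S) (Window γ) (Real.exp 1 * 9 * 64 * K₀ 64 8 ^ 2 * A) r₁ :=
  decayBound_functionalOn_of_termBound118 S R.toRunPairing R.embA sp hembA
    (termBound118_of_bound238_table₂ F k S (Window γ) (fun m => box γ m) sp sp' (fun m _ hg => restrictPrefix_mem_box hg m) hrestr han
      h238 hA hr₁ hrate hsmall)

open Classical in
/-- **L06 AT A LEVEL PAIRING ON A TABLE PAIR** — `DecayBound (R.EB S′ b) (Window γ) (e·9·64·K₀(64,8)²·A) r₁` for `b ∈ ]0, γ]`: run B's readings in `sp`, the clause,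
the per-step pair on `sp′`, the pairing datum `hpair` (an equality at the pairing of record), the clauses. [cite: Balaban1987RG1, (0.24)-(0.25) p.257 and (1.18) p.263; Balaban1988RG2Cluster, p.15 and (2.41) p.21] -/
theorem decayBound_EB_of_bound238_table₂ (S' : ClusterTower (F.P (k + 1)) 𝔸 M)
    (sp sp' : (j : ℕ) → (domSys (F.P (k + 1)) M j).Dom → Set (CPair (F.P (k + 1)) 𝔸)) {γ A Rr r₁ : ℝ}
    (hembB : ∀ (j : ℕ) (U : R.BgB) (Y : (domSys (F.P (k + 1)) M j).Dom), R.embB U ∈ sp j Y)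
    (hpair : ∀ X : W1.Dom (F.P k) M,
      (domSys (F.P k) M X.1).dj X.2 ≤ (domSys (F.P (k + 1)) M (R.pair X).1).dj (R.pair X).2)
    (hrestr : ∀ m, ∀ X Z : (domSys (F.P (k + 1)) M (m + 1)).Dom, Z.1 ⊆ X.1 → sp (m + 1) X ⊆ sp' (m + 1) Z)
    (han : ∀ m, (S' m).AnalyticH (box γ m) (sp' (m + 1))) (h238 : ∀ m, (S' m).Bound238 (box γ m) (sp' (m + 1)) A Rr) (hA : 0 ≤ A)
    (hr₁ : 0 ≤ r₁) (hrate : r₁ + 2 * (64 * Real.log 162) + 2 ≤ Rr) (hsmall : A * Real.exp (5 * r₁ + 1) * K₀ 64 8 * 9 * 64 < 1) {b : ℝ}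
    (hb : b ∈ Ioc (0 : ℝ) γ) :
    DecayBound (R.EB S' b) (Window γ) (Real.exp 1 * 9 * 64 * K₀ 64 8 ^ 2 * A) r₁ := by
  -- adapted from file 10 `decayBound_EB_of_bound238_table` (the (1.18) producer is file 21's pair version)
  have h118 := termBound118_of_bound238_table₂ F (k + 1) S' (Window γ) (fun m => box γ m) sp sp'
    (fun m _ hg => restrictPrefix_mem_box hg m) hrestr han h238 hA hr₁ hrate hsmall
  have hE₀ : 0 ≤ Real.exp 1 * 9 * 64 * K₀ 64 8 ^ 2 * A := by positivity
  intro g hg U X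
  have h := h118 (prependCoupling b g) (prependCoupling_mem_window hb hg) (R.pair X).1 (R.pair X).2 (R.embB U) (hembB _ U _)
  rw [LevelPairing.EB_apply, LevelPairing.carriers_d]
  calc |(functionalC S' (prependCoupling b g) (R.embB U) (R.pair X)).re|
      ≤ ‖functionalC S' (prependCoupling b g) (R.embB U) (R.pair X)‖ := Complex.abs_re_le_norm _
    _ ≤ Real.exp 1 * 9 * 64 * K₀ 64 8 ^ 2 * A * Real.exp (-(r₁ * (domSys (F.P (k + 1)) M (R.pair X).1).dj (R.pair X).2)) := h
    _ ≤ Real.exp 1 * 9 * 64 * K₀ 64 8 ^ 2 * A * Real.exp (-(r₁ * (domSys (F.P k) M X.1).dj X.2)) :=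
        mul_le_mul_of_nonneg_left (Real.exp_le_exp.2 (neg_le_neg (mul_le_mul_of_nonneg_left (hpair X) hr₁))) hE₀

end Reading

/-! ## §2 (STEP₂) at the admissible pairing of record -/

section Admissible

variable (F : T4Family) (M N k : ℕ) (sp : (k j : ℕ) → (domSys (F.P k) M j).Dom → Set (CPair (F.P k) (MatA N)))
  (gauge : GaugeField (F.P k) 0 (Node00.SU N) → GaugeField (F.P k) 0 (Node00.SU N) → ℝ) (hg : ∀ U U', 0 ≤ gauge U U')
  (T₀ : GaugeField (F.P (k + 1)) 0 (Node00.SU N) → GaugeField (F.P k) 0 (Node00.SU N))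
  (hT₀ : ∀ U : GaugeField (F.P (k + 1)) 0 (Node00.SU N),
    (∀ (j : ℕ) (Y : (domSys (F.P (k + 1)) M j).Dom), ofBackgroundC (ιSU N) U ∈ sp (k + 1) j Y) →
      ∀ (j : ℕ) (Y : (domSys (F.P k) M j).Dom), ofBackgroundC (ιSU N) (T₀ U) ∈ sp k j Y)

open Classical in
/-- **★ L05 AT THE ADMISSIBLE PAIRING OF RECORD FROM (STEP₂).**  Run A = the admissible backgrounds of `F.P k` for the table family `sp` (readings `(ιU, 0)` IN `sp k` by
type); the step's pair is asked on a LARGER family `spA′` on `F.P k` linked to `sp k` by print's clause `hrestr`; (STEP₂) for run A's tower, the located clauses and the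
renewal ⟹ `DecayBound ((LevelPairing.ofRecordAdm …).EA S) (Window γ) (e·9·64·K₀(64,8)²·A) r₁`. [cite: Balaban1987RG1, (0.25) p.257, (1.18) p.263 and Thm 1 p.259; Balaban1988RG2Cluster, p.15 and p.22] -/
theorem decayBound_EA_ofRecordAdm_of_inductiveStep₂ (S : ClusterTower (F.P k) (MatA N) M)
    (spA' : (j : ℕ) → (domSys (F.P k) M j).Dom → Set (CPair (F.P k) (MatA N))) {γ A Rr r₁ E₀ : ℝ}
    (hrestr : ∀ m, ∀ X Z : (domSys (F.P k) M (m + 1)).Dom, Z.1 ⊆ X.1 → sp k (m + 1) X ⊆ spA' (m + 1) Z)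
    (hstep : ∀ m : ℕ,
      (∀ g ∈ Window γ, ∀ j ≤ m, ∀ (X : (domSys (F.P k) M j).Dom), ∀ φ ∈ sp k j X,
          ‖termC S j X g φ‖ ≤ E₀ * Real.exp (-(r₁ * (domSys (F.P k) M j).dj X))) →
      (∀ g ∈ Window γ, ∀ j ≤ m, ∀ (X : (domSys (F.P k) M j).Dom), AnalyticOnNhd ℂ (termC S j X g) (sp k j X)) →
      (S m).AnalyticH (box γ m) (spA' (m + 1)) ∧ (S m).Bound238 (box γ m) (spA' (m + 1)) A Rr)
    (hA : 0 ≤ A) (hr₁ : 0 ≤ r₁) (hrate : r₁ + 2 * (64 * Real.log 162) + 2 ≤ Rr)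
    (hsmall : A * Real.exp (5 * r₁ + 1) * K₀ 64 8 * 9 * 64 < 1) (hrenew : Real.exp 1 * 9 * 64 * K₀ 64 8 ^ 2 * A ≤ E₀) :
    DecayBound ((LevelPairing.ofRecordAdm F M N k sp gauge hg T₀ hT₀).EA S) (Window γ) (Real.exp 1 * 9 * 64 * K₀ 64 8 ^ 2 * A) r₁ :=
  have hall := hLayer_all_of_inductiveStep₂ F k S (Window γ) (fun m => box γ m) (sp k) spA' (fun m _ hg => restrictPrefix_mem_box hg m) hrestr
    hstep hA hr₁ hrate hsmall hrenew
  decayBound_EA_of_bound238_table₂ (LevelPairing.ofRecordAdm F M N k sp gauge hg T₀ hT₀) S (sp k) spA'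
    (fun j U X => LevelPairing.ofRecordAdm_embA_mem F M N k sp gauge hg T₀ hT₀ U j X) hrestr (fun m => (hall m).1) (fun m => (hall m).2) hA hr₁
    hrate hsmall

open Classical in
/-- **★ L06 AT THE ADMISSIBLE PAIRING OF RECORD FROM (STEP₂)**: run B's tower `S′` on `F.P (k+1)`, readings in `sp (k+1)` by type, the step's pair on a larger family
`spB′` linked by print's clause, the pairing of record preserving `d_j` ⟹ for every `b ∈ ]0, γ]`, `DecayBound ((LevelPairing.ofRecordAdm …).EB S′ b) (Window γ)
(e·9·64·K₀(64,8)²·A) r₁`. [cite: Balaban1987RG1, (0.24)-(0.25) p.257, (1.18) p.263 and Thm 1 p.259; Balaban1988RG2Cluster, p.15 and p.22] -/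
theorem decayBound_EB_ofRecordAdm_of_inductiveStep₂ (S' : ClusterTower (F.P (k + 1)) (MatA N) M)
    (spB' : (j : ℕ) → (domSys (F.P (k + 1)) M j).Dom → Set (CPair (F.P (k + 1)) (MatA N))) {γ A Rr r₁ E₀ : ℝ}
    (hrestr : ∀ m, ∀ X Z : (domSys (F.P (k + 1)) M (m + 1)).Dom, Z.1 ⊆ X.1 → sp (k + 1) (m + 1) X ⊆ spB' (m + 1) Z)
    (hstep : ∀ m : ℕ,
      (∀ g ∈ Window γ, ∀ j ≤ m, ∀ (Y : (domSys (F.P (k + 1)) M j).Dom), ∀ φ ∈ sp (k + 1) j Y,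
          ‖termC S' j Y g φ‖ ≤ E₀ * Real.exp (-(r₁ * (domSys (F.P (k + 1)) M j).dj Y))) →
      (∀ g ∈ Window γ, ∀ j ≤ m, ∀ (Y : (domSys (F.P (k + 1)) M j).Dom), AnalyticOnNhd ℂ (termC S' j Y g) (sp (k + 1) j Y)) →
      (S' m).AnalyticH (box γ m) (spB' (m + 1)) ∧ (S' m).Bound238 (box γ m) (spB' (m + 1)) A Rr)
    (hA : 0 ≤ A) (hr₁ : 0 ≤ r₁) (hrate : r₁ + 2 * (64 * Real.log 162) + 2 ≤ Rr)
    (hsmall : A * Real.exp (5 * r₁ + 1) * K₀ 64 8 * 9 * 64 < 1) (hrenew : Real.exp 1 * 9 * 64 * K₀ 64 8 ^ 2 * A ≤ E₀) {b : ℝ}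
    (hb : b ∈ Ioc (0 : ℝ) γ) :
    DecayBound ((LevelPairing.ofRecordAdm F M N k sp gauge hg T₀ hT₀).EB S' b) (Window γ) (Real.exp 1 * 9 * 64 * K₀ 64 8 ^ 2 * A) r₁ :=
  have hall := hLayer_all_of_inductiveStep₂ F (k + 1) S' (Window γ) (fun m => box γ m) (sp (k + 1)) spB' (fun m _ hg => restrictPrefix_mem_box hg m)
    hrestr hstep hA hr₁ hrate hsmall hrenew
  decayBound_EB_of_bound238_table₂ (LevelPairing.ofRecordAdm F M N k sp gauge hg T₀ hT₀) S' (sp (k + 1)) spB'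
    (fun j U Y => LevelPairing.ofRecordAdm_embB_mem F M N k sp gauge hg T₀ hT₀ U j Y) (fun X => (dj_pairOfRecord F M k X).symm.le) hrestr
    (fun m => (hall m).1) (fun m => (hall m).2) hA hr₁ hrate hsmall hb

end Admissible

/-! ## §3 (GEN₂): node00-def-W1's generated towers on a table pair -/

section Generated

variable (F : T4Family) (K : ℕ) {𝔸 : Type*} [NormedRing 𝔸] [NormedAlgebra ℂ 𝔸] {M : ℕ}

open Classical in
/-- **★ (GEN₂) AT EVERY STEP ⟹ EVERY GENERATED TERM OBEYS BOTH INDUCTIVE ASSUMPTIONS ON `sp`** — file 17 §1 on a pair: the per-generator schema asks the activity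
`(G k).H t old` analytic at the points of `sp′ (k+1) Z` and (2.38)-bounded on `sp′ (k+1) Z` given older terms admissible ON `sp` ((1.18)`(E₀,r₁)` + analyticity);
print's clause `hrestr` links the tables; strong induction on the level with file 21's pair version of file 10. [cite: Balaban1987RG1, Thm 1 p.259, (1.18) p.263 and (2.13) p.268; Balaban1988RG2Cluster, (2.14) p.15, p.15, Lemma 3 (2.38) p.20, (2.41) p.21] -/
theorem recTerm_inductiveAssumptions_of_stepGen₂ (G : GenTower (F.P K) 𝔸 M) (D : Set ℂ)
    (sp sp' : (j : ℕ) → (domSys (F.P K) M j).Dom → Set (CPair (F.P K) 𝔸)) {A R r₁ E₀ : ℝ}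
    (hrestr : ∀ k, ∀ X Z : (domSys (F.P K) M (k + 1)).Dom, Z.1 ⊆ X.1 → sp (k + 1) X ⊆ sp' (k + 1) Z)
    (hgen : ∀ k : ℕ, ∀ t ∈ D, ∀ old : OlderTerms (F.P K) 𝔸 M k,
      (∀ (j : Fin (k + 1)) (Y : (domSys (F.P K) M j).Dom), ∀ ψ ∈ sp j Y,
          ‖old j Y ψ‖ ≤ E₀ * Real.exp (-(r₁ * (domSys (F.P K) M j).dj Y))) →
      (∀ (j : Fin (k + 1)) (Y : (domSys (F.P K) M j).Dom), AnalyticOnNhd ℂ (old j Y) (sp j Y)) →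
      (∀ Z : (domSys (F.P K) M (k + 1)).Dom, AnalyticOnNhd ℂ (fun φ => (G k).H t old φ Z) (sp' (k + 1) Z)) ∧
      (∀ (Z : (domSys (F.P K) M (k + 1)).Dom), ∀ φ ∈ sp' (k + 1) Z,
          ‖(G k).H t old φ Z‖ ≤ A * Real.exp (-(R * (domSys (F.P K) M (k + 1)).dj Z))))
    (hA : 0 ≤ A) (hr₁ : 0 ≤ r₁) (hrate : r₁ + 2 * (64 * Real.log 162) + 2 ≤ R)
    (hsmall : A * Real.exp (5 * r₁ + 1) * K₀ 64 8 * 9 * 64 < 1) (hrenew : Real.exp 1 * 9 * 64 * K₀ 64 8 ^ 2 * A ≤ E₀)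
    (g : ℕ → ℂ) (hg : ∀ n, g n ∈ D) :
    ∀ (j : ℕ) (X : (domSys (F.P K) M j).Dom),
      (∀ φ ∈ sp j X, ‖recTerm G g j X φ‖ ≤ E₀ * Real.exp (-(r₁ * (domSys (F.P K) M j).dj X))) ∧
      AnalyticOnNhd ℂ (recTerm G g j X) (sp j X) := by
  -- adapted from file 17 `recTerm_inductiveAssumptions_of_stepGen` (the step's pair is read on `sp′` through file 21 §2)
  have hM : 0 ≤ Real.exp 1 * 9 * 64 * K₀ 64 8 ^ 2 * A := by positivity
  have hE₀ : 0 ≤ E₀ := le_trans hM hrenew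
  intro j
  induction j using Nat.strong_induction_on with
  | _ j ih =>
    intro X
    cases j with
    | zero =>
      have h0 : recTerm G g 0 X = fun _ => 0 := funext fun φ => recTerm_zero G g X φ
      refine ⟨fun φ _ => ?_, ?_⟩
      · rw [recTerm_zero, norm_zero]; positivity
      · rw [h0]; exact analyticOnNhd_const
    | succ k =>
      obtain ⟨han, h238⟩ := hgen k (g k) (hg k) (olderOf (recTerm G g) k)
        (fun j' Y ψ hψ => (ih j'.1 j'.2 Y).1 ψ hψ) (fun j' Y => (ih j'.1 j'.2 Y).2)
      have key := analyticOnNhd_and_bound_E_of_bound238_table_four₂ F K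
        (⟨(G k).Idx, (G k).idx, fun i _ φ => (G k).T i (g k) (olderOf (recTerm G g) k) φ⟩ : ClusterStep (F.P K) 𝔸 M k)
        (Set.univ : Set (Fin (k + 1) → ℝ)) (sp (k + 1)) (sp' (k + 1)) (hrestr k) (fun _ _ Z => han Z) (fun _ _ Z φ hφ => h238 Z φ hφ) hA hr₁
        hrate hsmall (fun _ => 0) (Set.mem_univ _) X
      have hE : recTerm G g (k + 1) X = fun φ =>
          (⟨(G k).Idx, (G k).idx, fun i _ φ => (G k).T i (g k) (olderOf (recTerm G g) k) φ⟩ : ClusterStep (F.P K) 𝔸 M k).E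
            (fun _ => 0) φ X :=
        funext fun φ => recTerm_succ G g k X φ
      refine ⟨fun φ hφ => ?_, ?_⟩
      · rw [hE]
        exact (key.2 φ hφ).trans (mul_le_mul_of_nonneg_right hrenew (Real.exp_nonneg _))
      · rw [hE]
        exact key.1

open Classical in
/-- **W1's `RecAdmissible` FROM (GEN₂)** for the class «(1.18)`(E₀, r₁)` on `sp` + analytic there». [cite: Balaban1987RG1, §1 p.263 (the inductive assumptions) and Thm 1 p.259; Balaban1988RG2Cluster, p.15 and p.22] -/
theorem recAdmissible_of_stepGen₂ (G : GenTower (F.P K) 𝔸 M) (D : Set ℂ)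
    (sp sp' : (j : ℕ) → (domSys (F.P K) M j).Dom → Set (CPair (F.P K) 𝔸)) {A R r₁ E₀ : ℝ}
    (hrestr : ∀ k, ∀ X Z : (domSys (F.P K) M (k + 1)).Dom, Z.1 ⊆ X.1 → sp (k + 1) X ⊆ sp' (k + 1) Z)
    (hgen : ∀ k : ℕ, ∀ t ∈ D, ∀ old : OlderTerms (F.P K) 𝔸 M k,
      (∀ (j : Fin (k + 1)) (Y : (domSys (F.P K) M j).Dom), ∀ ψ ∈ sp j Y,
          ‖old j Y ψ‖ ≤ E₀ * Real.exp (-(r₁ * (domSys (F.P K) M j).dj Y))) →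
      (∀ (j : Fin (k + 1)) (Y : (domSys (F.P K) M j).Dom), AnalyticOnNhd ℂ (old j Y) (sp j Y)) →
      (∀ Z : (domSys (F.P K) M (k + 1)).Dom, AnalyticOnNhd ℂ (fun φ => (G k).H t old φ Z) (sp' (k + 1) Z)) ∧
      (∀ (Z : (domSys (F.P K) M (k + 1)).Dom), ∀ φ ∈ sp' (k + 1) Z,
          ‖(G k).H t old φ Z‖ ≤ A * Real.exp (-(R * (domSys (F.P K) M (k + 1)).dj Z))))
    (hA : 0 ≤ A) (hr₁ : 0 ≤ r₁) (hrate : r₁ + 2 * (64 * Real.log 162) + 2 ≤ R)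
    (hsmall : A * Real.exp (5 * r₁ + 1) * K₀ 64 8 * 9 * 64 < 1) (hrenew : Real.exp 1 * 9 * 64 * K₀ 64 8 ^ 2 * A ≤ E₀) :
    RecAdmissible G D fun k => {old : OlderTerms (F.P K) 𝔸 M k |
      (∀ (j : Fin (k + 1)) (Y : (domSys (F.P K) M j).Dom), ∀ ψ ∈ sp j Y,
          ‖old j Y ψ‖ ≤ E₀ * Real.exp (-(r₁ * (domSys (F.P K) M j).dj Y))) ∧
      (∀ (j : Fin (k + 1)) (Y : (domSys (F.P K) M j).Dom), AnalyticOnNhd ℂ (old j Y) (sp j Y))} :=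
  fun g hg _ =>
    ⟨fun j Y ψ hψ => (recTerm_inductiveAssumptions_of_stepGen₂ F K G D sp sp' hrestr hgen hA hr₁ hrate hsmall hrenew g hg j.1 Y).1 ψ hψ,
      fun j Y => (recTerm_inductiveAssumptions_of_stepGen₂ F K G D sp sp' hrestr hgen hA hr₁ hrate hsmall hrenew g hg j.1 Y).2⟩

open Classical in
/-- **(1.18) FOR THE GENERATED TOWER ON `sp` FROM (GEN₂)**, every history set `W` read inside `D`. [cite: Balaban1987RG1, (1.18) p.263 and Thm 1 p.259; Balaban1988RG2Cluster, (2.41) p.21 and p.22] -/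
theorem termBound118_toClusterTower_of_stepGen₂ (G : GenTower (F.P K) 𝔸 M) (D : Set ℂ)
    (sp sp' : (j : ℕ) → (domSys (F.P K) M j).Dom → Set (CPair (F.P K) 𝔸)) {A R r₁ E₀ : ℝ}
    (hrestr : ∀ k, ∀ X Z : (domSys (F.P K) M (k + 1)).Dom, Z.1 ⊆ X.1 → sp (k + 1) X ⊆ sp' (k + 1) Z)
    (hgen : ∀ k : ℕ, ∀ t ∈ D, ∀ old : OlderTerms (F.P K) 𝔸 M k,
      (∀ (j : Fin (k + 1)) (Y : (domSys (F.P K) M j).Dom), ∀ ψ ∈ sp j Y,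
          ‖old j Y ψ‖ ≤ E₀ * Real.exp (-(r₁ * (domSys (F.P K) M j).dj Y))) →
      (∀ (j : Fin (k + 1)) (Y : (domSys (F.P K) M j).Dom), AnalyticOnNhd ℂ (old j Y) (sp j Y)) →
      (∀ Z : (domSys (F.P K) M (k + 1)).Dom, AnalyticOnNhd ℂ (fun φ => (G k).H t old φ Z) (sp' (k + 1) Z)) ∧
      (∀ (Z : (domSys (F.P K) M (k + 1)).Dom), ∀ φ ∈ sp' (k + 1) Z,
          ‖(G k).H t old φ Z‖ ≤ A * Real.exp (-(R * (domSys (F.P K) M (k + 1)).dj Z))))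
    (hA : 0 ≤ A) (hr₁ : 0 ≤ r₁) (hrate : r₁ + 2 * (64 * Real.log 162) + 2 ≤ R)
    (hsmall : A * Real.exp (5 * r₁ + 1) * K₀ 64 8 * 9 * 64 < 1) (hrenew : Real.exp 1 * 9 * 64 * K₀ 64 8 ^ 2 * A ≤ E₀)
    (W : Set (ℕ → ℝ)) (hW : ∀ g ∈ W, ∀ n, ((g n : ℝ) : ℂ) ∈ D) :
    TermBound118 (toClusterTower G) W sp E₀ r₁ := fun g hgW j X φ hφ => by
  rw [termC_toClusterTower]
  exact (recTerm_inductiveAssumptions_of_stepGen₂ F K G D sp sp' hrestr hgen hA hr₁ hrate hsmall hrenew _ (hW g hgW) j X).1 φ hφ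

open Classical in
/-- **[I] p. 263 ANALYTICITY FOR THE GENERATED TOWER ON `sp` FROM (GEN₂)**. [cite: Balaban1987RG1, §1 p.263 and Thm 1 p.259; Balaban1988RG2Cluster, p.15] -/
theorem termAnalytic_toClusterTower_of_stepGen₂ (G : GenTower (F.P K) 𝔸 M) (D : Set ℂ)
    (sp sp' : (j : ℕ) → (domSys (F.P K) M j).Dom → Set (CPair (F.P K) 𝔸)) {A R r₁ E₀ : ℝ}
    (hrestr : ∀ k, ∀ X Z : (domSys (F.P K) M (k + 1)).Dom, Z.1 ⊆ X.1 → sp (k + 1) X ⊆ sp' (k + 1) Z)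
    (hgen : ∀ k : ℕ, ∀ t ∈ D, ∀ old : OlderTerms (F.P K) 𝔸 M k,
      (∀ (j : Fin (k + 1)) (Y : (domSys (F.P K) M j).Dom), ∀ ψ ∈ sp j Y,
          ‖old j Y ψ‖ ≤ E₀ * Real.exp (-(r₁ * (domSys (F.P K) M j).dj Y))) →
      (∀ (j : Fin (k + 1)) (Y : (domSys (F.P K) M j).Dom), AnalyticOnNhd ℂ (old j Y) (sp j Y)) →
      (∀ Z : (domSys (F.P K) M (k + 1)).Dom, AnalyticOnNhd ℂ (fun φ => (G k).H t old φ Z) (sp' (k + 1) Z)) ∧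
      (∀ (Z : (domSys (F.P K) M (k + 1)).Dom), ∀ φ ∈ sp' (k + 1) Z,
          ‖(G k).H t old φ Z‖ ≤ A * Real.exp (-(R * (domSys (F.P K) M (k + 1)).dj Z))))
    (hA : 0 ≤ A) (hr₁ : 0 ≤ r₁) (hrate : r₁ + 2 * (64 * Real.log 162) + 2 ≤ R)
    (hsmall : A * Real.exp (5 * r₁ + 1) * K₀ 64 8 * 9 * 64 < 1) (hrenew : Real.exp 1 * 9 * 64 * K₀ 64 8 ^ 2 * A ≤ E₀)
    (W : Set (ℕ → ℝ)) (hW : ∀ g ∈ W, ∀ n, ((g n : ℝ) : ℂ) ∈ D) :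
    TermAnalytic (toClusterTower G) W sp := fun g hgW j X => by
  have h : termC (toClusterTower G) j X g = recTerm G (fun n => ((g n : ℝ) : ℂ)) j X :=
    funext fun φ => termC_toClusterTower G g j X φ
  rw [h]
  exact (recTerm_inductiveAssumptions_of_stepGen₂ F K G D sp sp' hrestr hgen hA hr₁ hrate hsmall hrenew _ (hW g hgW) j X).2

end Generated

/-! ## §4 (GEN₂) at the admissible pairing of record -/

section GeneratedAdmissible

variable (F : T4Family) (M N k : ℕ) (sp : (k j : ℕ) → (domSys (F.P k) M j).Dom → Set (CPair (F.P k) (MatA N)))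
  (gauge : GaugeField (F.P k) 0 (Node00.SU N) → GaugeField (F.P k) 0 (Node00.SU N) → ℝ) (hg : ∀ U U', 0 ≤ gauge U U')
  (T₀ : GaugeField (F.P (k + 1)) 0 (Node00.SU N) → GaugeField (F.P k) 0 (Node00.SU N))
  (hT₀ : ∀ U : GaugeField (F.P (k + 1)) 0 (Node00.SU N),
    (∀ (j : ℕ) (Y : (domSys (F.P (k + 1)) M j).Dom), ofBackgroundC (ιSU N) U ∈ sp (k + 1) j Y) →
      ∀ (j : ℕ) (Y : (domSys (F.P k) M j).Dom), ofBackgroundC (ιSU N) (T₀ U) ∈ sp k j Y)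

open Classical in
/-- **★ L05 OF THE END AT THE ADMISSIBLE PAIRING OF RECORD FOR THE GENERATED TOWER, FROM (GEN₂) ALONE** (file 17 §3 on a pair: the generator's activities on the larger
family `spA′`, older terms and readings on `sp k`). [cite: Balaban1987RG1, (0.25) p.257, (1.18) p.263 and Thm 1 p.259; Balaban1988RG2Cluster, p.15 and p.22] -/
theorem decayBound_EA_ofRecordAdm_toClusterTower_of_stepGen₂ (G : GenTower (F.P k) (MatA N) M) (D : Set ℂ)
    (spA' : (j : ℕ) → (domSys (F.P k) M j).Dom → Set (CPair (F.P k) (MatA N))) {A R r₁ E₀ γ : ℝ}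
    (hrestr : ∀ m, ∀ X Z : (domSys (F.P k) M (m + 1)).Dom, Z.1 ⊆ X.1 → sp k (m + 1) X ⊆ spA' (m + 1) Z)
    (hgen : ∀ m : ℕ, ∀ t ∈ D, ∀ old : OlderTerms (F.P k) (MatA N) M m,
      (∀ (j : Fin (m + 1)) (Y : (domSys (F.P k) M j).Dom), ∀ ψ ∈ sp k j Y,
          ‖old j Y ψ‖ ≤ E₀ * Real.exp (-(r₁ * (domSys (F.P k) M j).dj Y))) →
      (∀ (j : Fin (m + 1)) (Y : (domSys (F.P k) M j).Dom), AnalyticOnNhd ℂ (old j Y) (sp k j Y)) →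
      (∀ Z : (domSys (F.P k) M (m + 1)).Dom, AnalyticOnNhd ℂ (fun φ => (G m).H t old φ Z) (spA' (m + 1) Z)) ∧
      (∀ (Z : (domSys (F.P k) M (m + 1)).Dom), ∀ φ ∈ spA' (m + 1) Z,
          ‖(G m).H t old φ Z‖ ≤ A * Real.exp (-(R * (domSys (F.P k) M (m + 1)).dj Z))))
    (hA : 0 ≤ A) (hr₁ : 0 ≤ r₁) (hrate : r₁ + 2 * (64 * Real.log 162) + 2 ≤ R)
    (hsmall : A * Real.exp (5 * r₁ + 1) * K₀ 64 8 * 9 * 64 < 1) (hrenew : Real.exp 1 * 9 * 64 * K₀ 64 8 ^ 2 * A ≤ E₀)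
    (hD : ∀ s ∈ Ioc (0 : ℝ) γ, ((s : ℝ) : ℂ) ∈ D) :
    DecayBound ((LevelPairing.ofRecordAdm F M N k sp gauge hg T₀ hT₀).EA (toClusterTower G)) (Window γ) E₀ r₁ := by
  rw [LevelPairing.EA_eq]
  exact decayBound_functionalOn_of_termBound118 (toClusterTower G) _ _ (sp k)
    (fun j U X => LevelPairing.ofRecordAdm_embA_mem F M N k sp gauge hg T₀ hT₀ U j X)
    (termBound118_toClusterTower_of_stepGen₂ F k G D (sp k) spA' hrestr hgen hA hr₁ hrate hsmall hrenew (Window γ)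
      fun g hgW n => hD _ (hgW n))

open Classical in
/-- **★ L06 OF THE END AT THE ADMISSIBLE PAIRING OF RECORD FOR A GENERATED RUN-B TOWER, FROM (GEN₂) ALONE** (file 17 §3 on a pair; the pairing of record preserves
`d_j`; the history `b∷g` stays in the window). [cite: Balaban1987RG1, (0.24)-(0.25) p.257, (1.18) p.263 and Thm 1 p.259; Balaban1988RG2Cluster, p.15 and p.22] -/
theorem decayBound_EB_ofRecordAdm_toClusterTower_of_stepGen₂ (G' : GenTower (F.P (k + 1)) (MatA N) M) (D : Set ℂ)
    (spB' : (j : ℕ) → (domSys (F.P (k + 1)) M j).Dom → Set (CPair (F.P (k + 1)) (MatA N))) {A R r₁ E₀ γ : ℝ}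
    (hrestr : ∀ m, ∀ X Z : (domSys (F.P (k + 1)) M (m + 1)).Dom, Z.1 ⊆ X.1 → sp (k + 1) (m + 1) X ⊆ spB' (m + 1) Z)
    (hgen : ∀ m : ℕ, ∀ t ∈ D, ∀ old : OlderTerms (F.P (k + 1)) (MatA N) M m,
      (∀ (j : Fin (m + 1)) (Y : (domSys (F.P (k + 1)) M j).Dom), ∀ ψ ∈ sp (k + 1) j Y,
          ‖old j Y ψ‖ ≤ E₀ * Real.exp (-(r₁ * (domSys (F.P (k + 1)) M j).dj Y))) →
      (∀ (j : Fin (m + 1)) (Y : (domSys (F.P (k + 1)) M j).Dom), AnalyticOnNhd ℂ (old j Y) (sp (k + 1) j Y)) →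
      (∀ Z : (domSys (F.P (k + 1)) M (m + 1)).Dom, AnalyticOnNhd ℂ (fun φ => (G' m).H t old φ Z) (spB' (m + 1) Z)) ∧
      (∀ (Z : (domSys (F.P (k + 1)) M (m + 1)).Dom), ∀ φ ∈ spB' (m + 1) Z,
          ‖(G' m).H t old φ Z‖ ≤ A * Real.exp (-(R * (domSys (F.P (k + 1)) M (m + 1)).dj Z))))
    (hA : 0 ≤ A) (hr₁ : 0 ≤ r₁) (hrate : r₁ + 2 * (64 * Real.log 162) + 2 ≤ R)
    (hsmall : A * Real.exp (5 * r₁ + 1) * K₀ 64 8 * 9 * 64 < 1) (hrenew : Real.exp 1 * 9 * 64 * K₀ 64 8 ^ 2 * A ≤ E₀)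
    (hD : ∀ s ∈ Ioc (0 : ℝ) γ, ((s : ℝ) : ℂ) ∈ D) {b : ℝ} (hb : b ∈ Ioc (0 : ℝ) γ) :
    DecayBound ((LevelPairing.ofRecordAdm F M N k sp gauge hg T₀ hT₀).EB (toClusterTower G') b) (Window γ) E₀ r₁ := by
  -- adapted from file 17 `decayBound_EB_ofRecordAdm_toClusterTower_of_stepGen` (§3's pair version of (1.18) at the history `b∷g`)
  have h118 := termBound118_toClusterTower_of_stepGen₂ F (k + 1) G' D (sp (k + 1)) spB' hrestr hgen hA hr₁ hrate hsmall hrenew (Window γ)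
    fun g hgW n => hD _ (hgW n)
  have hM : 0 ≤ Real.exp 1 * 9 * 64 * K₀ 64 8 ^ 2 * A := by positivity
  have hE₀ : 0 ≤ E₀ := le_trans hM hrenew
  intro g hgW U X
  have h := h118 (prependCoupling b g) (prependCoupling_mem_window hb hgW)
    ((LevelPairing.ofRecordAdm F M N k sp gauge hg T₀ hT₀).pair X).1 ((LevelPairing.ofRecordAdm F M N k sp gauge hg T₀ hT₀).pair X).2
    ((LevelPairing.ofRecordAdm F M N k sp gauge hg T₀ hT₀).embB U)
    (LevelPairing.ofRecordAdm_embB_mem F M N k sp gauge hg T₀ hT₀ U _ _)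
  have hpair : (domSys (F.P k) M X.1).dj X.2 ≤
      (domSys (F.P (k + 1)) M ((LevelPairing.ofRecordAdm F M N k sp gauge hg T₀ hT₀).pair X).1).dj
        ((LevelPairing.ofRecordAdm F M N k sp gauge hg T₀ hT₀).pair X).2 :=
    (dj_pairOfRecord F M k X).symm.le
  rw [LevelPairing.EB_apply, LevelPairing.carriers_d]
  calc |(functionalC (toClusterTower G') (prependCoupling b g) ((LevelPairing.ofRecordAdm F M N k sp gauge hg T₀ hT₀).embB U)
          ((LevelPairing.ofRecordAdm F M N k sp gauge hg T₀ hT₀).pair X)).re|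
      ≤ ‖functionalC (toClusterTower G') (prependCoupling b g) ((LevelPairing.ofRecordAdm F M N k sp gauge hg T₀ hT₀).embB U)
          ((LevelPairing.ofRecordAdm F M N k sp gauge hg T₀ hT₀).pair X)‖ := Complex.abs_re_le_norm _
    _ ≤ E₀ * Real.exp (-(r₁ * (domSys (F.P (k + 1)) M ((LevelPairing.ofRecordAdm F M N k sp gauge hg T₀ hT₀).pair X).1).dj
          ((LevelPairing.ofRecordAdm F M N k sp gauge hg T₀ hT₀).pair X).2)) := h
    _ ≤ E₀ * Real.exp (-(r₁ * (domSys (F.P k) M X.1).dj X.2)) :=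
        mul_le_mul_of_nonneg_left (Real.exp_le_exp.2 (neg_le_neg (mul_le_mul_of_nonneg_left hpair hr₁))) hE₀

end GeneratedAdmissible

end Summit.QuantumFields.YangMills.BalabanUVNodes.N18HLayerW1TwoRadiiReading

end
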